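import Literature.Geometry.GeometricMeasureTheory.SegmentCurrents
import Literature.Geometry.GeometricMeasureTheory.IntegralCurrentsFlatCompactness
import HarnessLib

/-!
# The flat-Cauchy half of Federer–Fleming compactness in dimension one, and the reduction of
# the compactness theorem to the closure theorem in all dimensions

`IntegralCurrentsFlatCompactness.lean` proves the flat-Cauchy half of [Federer1969, 4.2.17 (2)] for
integral currents of dimension `≥ 2` (cones over the boundaries). Dimension `1` needs the total
boundedness of bounded families of integral `0`-currents, which for the finite `0`-chains
`[F, n] = Σ n(x) δ_x` of `IntegralCurrentsDimZero.lean` is elementary: move every point mass to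
the nearest point of a finite `ε`-net of the ball, the difference being the boundary of a sum of
segment currents (`SegmentCurrents.lean`) of total mass `≤ ε Σ |n(x)|` [Federer1969, 4.2.9 for
`m = 0`; 4.1.25]. The passage to dimension `1` then avoids cones: along a subsequence on which
the boundaries `∂Tᵢ` are flat-Cauchy with data `∂Tᵢ₊₁ − ∂Tᵢ = ∂S^B_i`, the corrected currents
`Tᵢ − Σ_{l<i} S^B_l − T₀` are rectifiable CYCLES, to which the cycle engine
`Current.exists_strictMono_sub_eq_boundary` applies.

* `Current.exists_finite_flatNet_zero` — the `0`-dimensional `δ`-net with segment data;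
* `Current.exists_strictMono_sub_eq_boundary_zero` — flat-Cauchy subsequences with data for
  bounded sequences in `𝓡_0(V) = 𝐈_0(V)`;
* `Current.exists_subseq_flatLimit_of_isIntegral_one` — **compactness for `𝐈_1(V)` modulo
  closure**: a sequence `Tᵢ ∈ 𝐈_1(V)` with `spt Tᵢ ⊆ 𝐁(x₀, ρ)`, `𝐍(Tᵢ) ≤ c < ∞` has a subsequence
  converging in `𝓕` (and weakly) to an integral flat chain `T'` with `spt T' ⊆ 𝐁(x₀, ρ)`,
  `𝐍(T') ≤ c`;
* **`Federer1969_compactness_of_closure`** — the named fact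
  `Federer1969_compactness_integralCurrents` (all dimensions) follows from the closure theorem
  [Federer1969, 4.2.16 (1)] ALONE, in the form "weak limits of `𝐍`-bounded sequences of integral
  currents supported in a compact set are integral currents".

Theorems only; no definitions, no named facts.

## References

* H. Federer, *Geometric Measure Theory*, Grundlehren 153, Springer 1969, 4.1.24, 4.1.25, 4.2.9,
  4.2.16, 4.2.17 [Federer1969].
-/

noncomputable section

open scoped ENNReal NNReal Topology
open MeasureTheory TopologicalSpace Set Filter Metric Function

namespace Literature.Geometry.GeometricMeasureTheory

set_option maxSynthPendingDepth 2

variable {V : Type*} [NormedAddCommGroup V] [InnerProductSpace ℝ V] [FiniteDimensional ℝ V]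
  [MeasurableSpace V] [BorelSpace V]

/-! ### Finite sums of currents -/

section FinsetSum

variable {m : ℕ}

/-- Finite sums of rectifiable currents are rectifiable ("`𝓡_{m,K}(U)` is an additive subgroup").
[cite: Federer1969, 4.1.24] -/
theorem Current.IsRectifiable.finsetSum_top {ι : Type*} (s : Finset ι)
    (R : ι → Current (⊤ : Opens V) m) (hR : ∀ i ∈ s, (R i).IsRectifiable) :
    (∑ i ∈ s, R i).IsRectifiable := by
  classical
  induction s using Finset.induction_on with
  | empty => simpa using Current.isRectifiable_zero
  | insert a s ha ih =>
    rw [Finset.sum_insert ha]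
    exact (hR a (Finset.mem_insert_self a s)).add_top
      (ih fun i hi => hR i (Finset.mem_insert_of_mem hi))

omit [InnerProductSpace ℝ V] [FiniteDimensional ℝ V] [MeasurableSpace V] [BorelSpace V] in
/-- Supports of finite sums. [cite: Federer1969, 4.1.1] -/
theorem Current.support_finsetSum_subset [NormedSpace ℝ V] {ι : Type*} (s : Finset ι)
    (R : ι → Current (⊤ : Opens V) m) {K : Set V} (hR : ∀ i ∈ s, (R i).support ⊆ K) :
    (∑ i ∈ s, R i).support ⊆ K := by
  classical
  induction s using Finset.induction_on with
  | empty => simp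
  | insert a s ha ih =>
    rw [Finset.sum_insert ha]
    exact (Current.support_add_subset _ _).trans (union_subset (hR a (Finset.mem_insert_self a s))
      (ih fun i hi => hR i (Finset.mem_insert_of_mem hi)))

omit [InnerProductSpace ℝ V] [FiniteDimensional ℝ V] [MeasurableSpace V] [BorelSpace V] in
/-- `∂` commutes with finite sums. [cite: Federer1969, 4.1.7] -/
theorem Current.boundary_finsetSum [NormedSpace ℝ V] {ι : Type*} (s : Finset ι)
    (S : ι → Current (⊤ : Opens V) (m + 1)) :
    (∑ i ∈ s, S i).boundary = ∑ i ∈ s, (S i).boundary := by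
  classical
  induction s using Finset.induction_on with
  | empty => simp
  | insert a s ha ih => rw [Finset.sum_insert ha, Finset.sum_insert ha, Current.boundary_add, ih]

/-- `Σ_{l ∈ [a, b)} 2 · 2^{-l} ≤ 4 · 2^{-a}`. [folklore] -/
private theorem sum_Ico_two_mul_half_pow_le (a b : ℕ) :
    (∑ l ∈ Finset.Ico a b, (2 : ℝ≥0∞) * 2⁻¹ ^ l) ≤ 4 * 2⁻¹ ^ a := by
  rw [Finset.sum_Ico_eq_sum_range]
  calc (∑ k ∈ Finset.range (b - a), (2 : ℝ≥0∞) * 2⁻¹ ^ (a + k))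
      = 2 * 2⁻¹ ^ a * ∑ k ∈ Finset.range (b - a), (2⁻¹ : ℝ≥0∞) ^ k := by
        rw [Finset.mul_sum]; refine Finset.sum_congr rfl fun k _ => ?_; rw [pow_add]; ring
    _ ≤ 2 * 2⁻¹ ^ a * ∑' k : ℕ, (2⁻¹ : ℝ≥0∞) ^ k :=
        mul_le_mul' le_rfl (ENNReal.sum_le_tsum _)
    _ = 4 * 2⁻¹ ^ a := by
        rw [ENNReal.tsum_geometric, ENNReal.one_sub_inv_two, inv_inv]; ring

/-- `Σ_j 2 · 2^{-j} < ∞` in `ℝ≥0∞`. [folklore] -/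
private theorem tsum_two_mul_half_pow_ne_top' : (∑' j : ℕ, (2 : ℝ≥0∞) * 2⁻¹ ^ j) ≠ ⊤ := by
  rw [ENNReal.tsum_mul_left, ENNReal.tsum_geometric, ENNReal.one_sub_inv_two, inv_inv]
  norm_num

end FinsetSum

/-! ### The `0`-dimensional net -/

section NetZero

omit [FiniteDimensional ℝ V] in
/-- `‖k‖ₑ = |k|` for an integer viewed in `ℝ`. [folklore] -/
private theorem enorm_intCast (k : ℤ) : ‖(k : ℝ)‖ₑ = (k.natAbs : ℝ≥0∞) := by
  rw [← ofReal_norm, Real.norm_eq_abs, ← Int.cast_abs, Int.abs_eq_natAbs, Int.cast_natCast,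
    ENNReal.ofReal_natCast]

omit [FiniteDimensional ℝ V] in
/-- `[F, n] = Σ_{x ∈ F} [{x}, n(x)]`: a finite `0`-chain is the sum of its point masses.
[cite: Federer1969, 4.1.25] -/
theorem currentOfIntegration_finset_eq_sum_singleton (F : Finset V) (n : V → ℤ) :
    (currentOfIntegration ↑F n (fun _ => ![]) : Current (⊤ : Opens V) 0) =
      ∑ x ∈ F, currentOfIntegration {x} (fun _ => n x) (fun _ => ![]) := by
  ext φ
  rw [currentOfIntegration_finset_apply, _root_.sum_apply]
  exact Finset.sum_congr rfl fun x _ => (currentOfIntegration_singleton_apply x (n x) φ).symm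

/-- **Total boundedness of bounded families of integral `0`-currents, with the data**
[Federer1969, 4.2.9 / 4.2.17 for `m = 0`; 4.1.25]: for `δ > 0` there is a finite set `Pset ⊆ 𝓡_0(V)`
such that every `T ∈ 𝓡_0(V)` with `spt T ⊆ 𝐁(x₀, ρ)` and `𝐌(T) ≤ c` satisfies `T − P = ∂S` for some
`P ∈ Pset` and some `S ∈ 𝓡_1(V)` with `spt S ⊆ 𝐁(x₀, ρ⁺ + δ)` and `𝐌(S) ≤ δ`: write `T = Σ n(x) δ_x`
(`Current.IsRectifiable.exists_finset_eq_currentOfIntegration`), move each `x` to a point `z(x)` of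
a finite `ε`-net of the ball (`ε Σ|n| ≤ δ`), `P = Σ n(x) δ_{z(x)}`, `S = Σ n(x) ⟦z(x), x⟧`
(`exists_segmentCurrent`). [cite: Federer1969, 4.2.17 (2), 4.1.25] -/
theorem Current.exists_finite_flatNet_zero (x₀ : V) (ρ : ℝ) {c : ℝ≥0∞} (hc : c ≠ ⊤) {δ : ℝ}
    (hδ : 0 < δ) :
    ∃ Pset : Set (Current (⊤ : Opens V) 0), Pset.Finite ∧ (∀ P ∈ Pset, P.IsRectifiable) ∧
      ∀ T : Current (⊤ : Opens V) 0, T.IsRectifiable → T.support ⊆ closedBall x₀ ρ → T.mass ≤ c →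
        ∃ P ∈ Pset, ∃ S : Current (⊤ : Opens V) 1, S.IsRectifiable ∧
          S.support ⊆ closedBall x₀ (max ρ 0 + δ) ∧ T - P = S.boundary ∧
          S.mass ≤ ENNReal.ofReal δ := by
  classical
  -- scale and net
  set ε : ℝ := δ / (c.toReal + 1) with hεdef
  have hε : 0 < ε := div_pos hδ (by positivity)
  have hεc : ENNReal.ofReal ε * c ≤ ENNReal.ofReal δ := by
    rw [← ENNReal.ofReal_toReal hc, ← ENNReal.ofReal_mul hε.le]
    refine ENNReal.ofReal_le_ofReal ?_
    rw [hεdef, div_mul_eq_mul_div, div_le_iff₀ (by positivity)]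
    nlinarith [ENNReal.toReal_nonneg (a := c)]
  have hεδ : ε ≤ δ := by
    rw [hεdef, div_le_iff₀ (by positivity)]; nlinarith [ENNReal.toReal_nonneg (a := c)]
  set K : Set V := closedBall x₀ ρ with hK
  obtain ⟨t, htK, htfin, hcover⟩ := finite_cover_balls_of_compact (isCompact_closedBall x₀ ρ) hε
  set Γ : Finset V := htfin.toFinset with hΓ
  -- the snapping map
  have hz : ∀ x, ∃ z : V, x ∈ K → z ∈ t ∧ dist x z < ε := by
    intro x
    by_cases hx : x ∈ K
    · obtain ⟨z, hz, hxz⟩ := mem_iUnion₂.1 (hcover hx)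
      exact ⟨z, fun _ => ⟨hz, mem_ball.1 hxz⟩⟩
    · exact ⟨x, fun h => (hx h).elim⟩
  choose z hz using hz
  -- the coefficient box
  set N : ℕ := ⌈c.toReal⌉₊ with hN
  set ext : (↥Γ → Set.Icc (-(N : ℤ)) N) → V → ℤ := fun m x =>
    if h : x ∈ Γ then ((m ⟨x, h⟩ : Set.Icc (-(N : ℤ)) N) : ℤ) else 0 with hext
  set Pset : Set (Current (⊤ : Opens V) 0) :=
    Set.range fun m : ↥Γ → Set.Icc (-(N : ℤ)) N => currentOfIntegration ↑Γ (ext m) fun _ => ![]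
  refine ⟨Pset, Set.finite_range _, ?_, fun T hT hTK hTc => ?_⟩
  · rintro _ ⟨m, rfl⟩
    exact isRectifiable_currentOfIntegration_finset Γ _ fun _ _ => trivial
  -- the given `0`-chain
  obtain ⟨F, n, hFT, hTeq, hmass⟩ := hT.exists_finset_eq_currentOfIntegration
  have hFK : ∀ x ∈ F, x ∈ K := fun x hx => hTK (hFT hx)
  have hzx : ∀ x ∈ F, z x ∈ t ∧ dist x (z x) < ε := fun x hx => hz x (hFK x hx)
  have hzΓ : ∀ x ∈ F, z x ∈ Γ := fun x hx => by rw [hΓ, Set.Finite.mem_toFinset]; exact (hzx x hx).1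
  -- bound on the multiplicities
  have hsum : (∑ x ∈ F, ((n x).natAbs : ℝ≥0∞)) ≤ c := hmass ▸ hTc
  have hsumN : (∑ x ∈ F, (n x).natAbs) ≤ N := by
    have h2 : ((∑ x ∈ F, (n x).natAbs : ℕ) : ℝ≥0∞) ≤ c := by push_cast; exact hsum
    have h3 : ((∑ x ∈ F, (n x).natAbs : ℕ) : ℝ) ≤ c.toReal := by
      have := ENNReal.toReal_mono hc h2
      rwa [ENNReal.toReal_natCast] at this
    exact_mod_cast h3.trans (Nat.le_ceil _)
  have hsumZ : (∑ x ∈ F, |n x|) ≤ (N : ℤ) := by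
    have : (∑ x ∈ F, |n x|) = ((∑ x ∈ F, (n x).natAbs : ℕ) : ℤ) := by
      rw [Nat.cast_sum]; exact Finset.sum_congr rfl fun x _ => (Int.natCast_natAbs (n x)).symm
    rw [this]; exact_mod_cast hsumN
  -- the moved chain `P = Σ n(x) δ_{z x} = [Γ, mΓ]`
  set mfun : V → ℤ := fun γ => ∑ x ∈ F with z x = γ, n x with hmfun
  have hmbound : ∀ γ, |mfun γ| ≤ N := fun γ => by
    calc |mfun γ| ≤ ∑ x ∈ F with z x = γ, |n x| := Finset.abs_sum_le_sum_abs _ _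
      _ ≤ ∑ x ∈ F, |n x| := Finset.sum_le_sum_of_subset_of_nonneg (Finset.filter_subset _ _)
          fun _ _ _ => abs_nonneg _
      _ ≤ N := hsumZ
  set mΓ : ↥Γ → Set.Icc (-(N : ℤ)) N := fun γ => ⟨mfun γ, abs_le.1 (hmbound γ)⟩ with hmΓ
  have hextm : ∀ γ ∈ Γ, ext mΓ γ = mfun γ := fun γ hγ => by simp [hext, hγ, hmΓ]
  set P : Current (⊤ : Opens V) 0 := currentOfIntegration ↑Γ (ext mΓ) fun _ => ![] with hP
  have hPapply : ∀ φ : TestForm (⊤ : Opens V) 0,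
      P φ = ∑ x ∈ F, (n x : ℝ) * φ (z x) ![] := by
    intro φ
    rw [hP, currentOfIntegration_finset_apply]
    calc (∑ γ ∈ Γ, (ext mΓ γ : ℝ) * φ γ ![])
        = ∑ γ ∈ Γ, ∑ x ∈ F with z x = γ, (n x : ℝ) * φ (z x) ![] := by
          refine Finset.sum_congr rfl fun γ hγ => ?_
          rw [hextm γ hγ, hmfun, Int.cast_sum, Finset.sum_mul]
          refine Finset.sum_congr rfl fun x hx => ?_
          rw [(Finset.mem_filter.1 hx).2]
      _ = ∑ x ∈ F, (n x : ℝ) * φ (z x) ![] := Finset.sum_fiberwise_of_maps_to hzΓ _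
  -- the segments
  choose Sx hSr hSspt hSm hSb using fun x : V => exists_segmentCurrent (n x) (z x) x
  set S : Current (⊤ : Opens V) 1 := ∑ x ∈ F, Sx x with hS
  have hsegK : ∀ x ∈ F, segment ℝ (z x) x ⊆ closedBall x₀ (max ρ 0 + δ) := fun x hx =>
    ((convex_closedBall x₀ ρ).segment_subset (htK (hzx x hx).1) (hFK x hx)).trans
      (closedBall_subset_closedBall (by linarith [le_max_left ρ 0]))
  refine ⟨P, ⟨mΓ, rfl⟩, S, ?_, ?_, ?_, ?_⟩
  · exact Current.IsRectifiable.finsetSum_top F Sx fun x _ => hSr x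
  · exact Current.support_finsetSum_subset F Sx fun x hx => (hSspt x).trans (hsegK x hx)
  · -- `T − P = ∂S`
    ext φ
    rw [_root_.sub_apply, hTeq, currentOfIntegration_finset_apply, hPapply, hS,
      Current.boundary_finsetSum, _root_.sum_apply, ← Finset.sum_sub_distrib]
    refine Finset.sum_congr rfl fun x _ => ?_
    rw [hSb x, _root_.sub_apply, currentOfIntegration_singleton_apply,
      currentOfIntegration_singleton_apply]
  · -- `𝐌(S) ≤ ε Σ |n(x)| ≤ δ`
    calc S.mass ≤ ∑ x ∈ F, (Sx x).mass := Current.mass_sum_le F Sx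
      _ ≤ ∑ x ∈ F, ENNReal.ofReal ε * ((n x).natAbs : ℝ≥0∞) := by
          refine Finset.sum_le_sum fun x hx => (hSm x).trans ?_
          rw [enorm_intCast, mul_comm]
          refine mul_le_mul' ?_ le_rfl
          rw [← ofReal_norm, ← dist_eq_norm]
          exact ENNReal.ofReal_le_ofReal (hzx x hx).2.le
      _ = ENNReal.ofReal ε * ∑ x ∈ F, ((n x).natAbs : ℝ≥0∞) := by rw [Finset.mul_sum]
      _ ≤ ENNReal.ofReal ε * c := mul_le_mul' le_rfl hsum
      _ ≤ ENNReal.ofReal δ := hεc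

/-- **Flat-Cauchy subsequences with data for bounded sequences of integral `0`-currents**
[Federer1969, 4.2.17 (2), proof, for `m = 0`]: `Bᵢ ∈ 𝓡_0(V)` with `spt ⊆ 𝐁(x₀, ρ)`, `𝐌 ≤ c < ∞`
admit `ι` strictly increasing and `S_j ∈ 𝓡_1(V)`, `spt S_j ⊆ 𝐁(x₀, ρ⁺ + 1)`, `𝐌(S_j) ≤ 2 · 2^{-j}`,
with `B (ι (j+1)) − B (ι j) = ∂ S_j` (nets `Current.exists_finite_flatNet_zero` and the diagonal
argument `exists_strictMono_forall_apply_eq`). [cite: Federer1969, 4.2.17 (2)] -/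
theorem Current.exists_strictMono_sub_eq_boundary_zero (x₀ : V) (ρ : ℝ) {c : ℝ≥0∞} (hc : c ≠ ⊤)
    (B : ℕ → Current (⊤ : Opens V) 0)
    (hB : ∀ i, (B i).IsRectifiable ∧ (B i).support ⊆ closedBall x₀ ρ ∧ (B i).mass ≤ c) :
    ∃ ι : ℕ → ℕ, StrictMono ι ∧ ∃ S : ℕ → Current (⊤ : Opens V) 1,
      ∀ j, (S j).IsRectifiable ∧ (S j).support ⊆ closedBall x₀ (max ρ 0 + 1) ∧
        B (ι (j + 1)) - B (ι j) = (S j).boundary ∧ (S j).mass ≤ 2 * 2⁻¹ ^ j := by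
  have hδ : ∀ k : ℕ, (0 : ℝ) < 2⁻¹ ^ k := fun k => by positivity
  choose Pset hfin hPset hnet using fun k => Current.exists_finite_flatNet_zero x₀ ρ hc (hδ k)
  choose P hPmem S hSr hSK hBP hSm using fun k i =>
    hnet k (B i) (hB i).1 (hB i).2.1 (hB i).2.2
  haveI : ∀ k, Finite ↥(Pset k) := fun k => (hfin k).to_subtype
  obtain ⟨ι, hι, hconst⟩ := exists_strictMono_forall_apply_eq
    (β := fun k => ↥(Pset k)) fun k i => ⟨P k i, hPmem k i⟩
  have hPeq : ∀ k j, k ≤ j → P k (ι j) = P k (ι k) := fun k j hkj =>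
    congrArg Subtype.val (hconst k j hkj)
  have h21 : ∀ j : ℕ, (2⁻¹ : ℝ) ^ j ≤ 1 := fun j => pow_le_one₀ (by norm_num) (by norm_num)
  refine ⟨ι, hι, fun j => S j (ι (j + 1)) - S j (ι j), fun j => ⟨?_, ?_, ?_, ?_⟩⟩
  · exact (hSr _ _).sub_top (hSr _ _)
  · refine (Current.support_sub_subset _ _).trans (union_subset ?_ ?_) <;>
      exact (hSK _ _).trans (closedBall_subset_closedBall (by linarith [h21 j]))
  · rw [Current.boundary_sub, ← hBP j (ι (j + 1)), ← hBP j (ι j), hPeq j (j + 1) (Nat.le_succ j)]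
    abel
  · calc (S j (ι (j + 1)) - S j (ι j)).mass
        ≤ (S j (ι (j + 1))).mass + (S j (ι j)).mass := Current.mass_sub_le_add _ _
      _ ≤ ENNReal.ofReal (2⁻¹ ^ j) + ENNReal.ofReal (2⁻¹ ^ j) := add_le_add (hSm _ _) (hSm _ _)
      _ = 2 * 2⁻¹ ^ j := by
          rw [ENNReal.ofReal_pow (by norm_num), ENNReal.ofReal_inv_of_pos (by norm_num),
            ENNReal.ofReal_ofNat, two_mul]

end NetZero

/-! ### Dimension one -/

section DimOne

/-- **Federer–Fleming compactness for integral `1`-currents, without the closure clause**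
[Federer1969, 4.2.17 (2), proof: complete + totally bounded]: a sequence `Tᵢ ∈ 𝐈_1(V)` with
`spt Tᵢ ⊆ 𝐁(x₀, ρ)` and `𝐍(Tᵢ) ≤ c < ∞` has a subsequence converging in the integral flat norm `𝓕`
(hence weakly) to an integral flat chain `T' ∈ 𝓕_1(V)` with `spt T' ⊆ 𝐁(x₀, ρ)` and `𝐍(T') ≤ c`.
Proof: along a subsequence `ι₁` the boundaries are flat-Cauchy with data
`∂T_{ι₁(l+1)} − ∂T_{ι₁ l} = ∂S^B_l` (`Current.exists_strictMono_sub_eq_boundary_zero`); the corrected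
currents `W_j = T_{ι₁ j} − T_{ι₁ 0} − Σ_{l<j} S^B_l` are bounded rectifiable CYCLES, flat-Cauchy
with data along a further subsequence (`Current.exists_strictMono_sub_eq_boundary`); along the
composite subsequence `T_{j+1} − T_j = Σ_{block} S^B_l + ∂S^Z_j` is summable flat-Cauchy data, and
the `𝓕`-completeness `Current.exists_flat_limit_of_tsum_ne_top` [Federer1969, 4.1.24] gives the
limit. [cite: Federer1969, 4.2.17 (2)] -/
theorem Current.exists_subseq_flatLimit_of_isIntegral_one (x₀ : V) (ρ : ℝ) {c : ℝ≥0∞}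
    (hc : c ≠ ⊤) (T : ℕ → Current (⊤ : Opens V) 1)
    (hT : ∀ i, (T i).IsIntegral ∧ (T i).support ⊆ closedBall x₀ ρ ∧ (T i).normalMass ≤ c) :
    ∃ (T' : Current (⊤ : Opens V) 1) (ι : ℕ → ℕ), StrictMono ι ∧
      T'.IsIntegralFlatChain ∧ T'.support ⊆ closedBall x₀ ρ ∧ T'.normalMass ≤ c ∧
      Tendsto (fun j => (T (ι j) - T').integralFlatNorm) atTop (𝓝 0) ∧
      ∀ φ, Tendsto (fun j => T (ι j) φ) atTop (𝓝 (T' φ)) := by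
  set ρ' : ℝ := max ρ 0 with hρ'
  have hρ'0 : 0 ≤ ρ' := le_max_right _ _
  have hρρ' : closedBall x₀ ρ ⊆ closedBall x₀ ρ' := closedBall_subset_closedBall (le_max_left _ _)
  set K₁ : Set V := closedBall x₀ (ρ' + 1) with hK₁
  have hρK₁ : closedBall x₀ ρ ⊆ K₁ := hρρ'.trans (closedBall_subset_closedBall (by linarith))
  -- the boundaries
  set B : ℕ → Current (⊤ : Opens V) 0 := fun i => (T i).boundary with hB
  have hBdata : ∀ i, (B i).IsRectifiable ∧ (B i).support ⊆ closedBall x₀ ρ ∧ (B i).mass ≤ c :=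
    fun i => ⟨(hT i).1.2, (T i).support_boundary_subset.trans (hT i).2.1,
      le_add_self.trans (hT i).2.2⟩
  -- step 1: the boundaries are flat-Cauchy with data along `ι₁`
  obtain ⟨ι₁, hι₁, SB, hSB⟩ := Current.exists_strictMono_sub_eq_boundary_zero x₀ ρ hc B hBdata
  -- step 2: the corrected cycles
  set W : ℕ → Current (⊤ : Opens V) 1 := fun j =>
    T (ι₁ j) - T (ι₁ 0) - ∑ l ∈ Finset.range j, SB l with hW
  have hWr : ∀ j, (W j).IsRectifiable := fun j =>
    ((hT _).1.1.sub_top (hT _).1.1).sub_top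
      (Current.IsRectifiable.finsetSum_top _ SB fun l _ => (hSB l).1)
  have hsumB : ∀ j, ∑ l ∈ Finset.range j, (SB l).boundary = B (ι₁ j) - B (ι₁ 0) := by
    intro j
    rw [← Finset.sum_range_sub (fun l => B (ι₁ l)) j]
    exact Finset.sum_congr rfl fun l _ => ((hSB l).2.2.1).symm
  have hWcyc : ∀ j, (W j).boundary = 0 := by
    intro j
    simp only [hW]
    rw [Current.boundary_sub, Current.boundary_sub, Current.boundary_finsetSum, hsumB]
    simp only [hB]; abel
  have hWspt : ∀ j, (W j).support ⊆ K₁ := fun j =>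
    (Current.support_sub_subset _ _).trans (union_subset
      ((Current.support_sub_subset _ _).trans (union_subset ((hT _).2.1.trans hρK₁)
        ((hT _).2.1.trans hρK₁)))
      (Current.support_finsetSum_subset _ SB fun l _ => (hSB l).2.1))
  have hWm : ∀ j, (W j).mass ≤ c + c + 4 := by
    intro j
    calc (W j).mass ≤ (T (ι₁ j) - T (ι₁ 0)).mass + (∑ l ∈ Finset.range j, SB l).mass :=
          Current.mass_sub_le_add _ _
      _ ≤ ((T (ι₁ j)).mass + (T (ι₁ 0)).mass) + ∑ l ∈ Finset.range j, (SB l).mass :=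
          add_le_add (Current.mass_sub_le_add _ _) (Current.mass_sum_le _ _)
      _ ≤ (c + c) + 4 * 2⁻¹ ^ 0 := by
          refine add_le_add (add_le_add (le_self_add.trans (hT _).2.2)
            (le_self_add.trans (hT _).2.2)) ?_
          rw [Finset.range_eq_Ico]
          exact (Finset.sum_le_sum fun l _ => (hSB l).2.2.2).trans (sum_Ico_two_mul_half_pow_le 0 j)
      _ = c + c + 4 := by rw [pow_zero, mul_one]
  have hcW : c + c + 4 ≠ ⊤ := by simp [hc]
  -- step 3: the cycle engine on `W`
  obtain ⟨ι₂, hι₂, hdata⟩ := Current.exists_strictMono_sub_eq_boundary (σ := Unit) (fun _ => 0) x₀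
    (ρ' + 1) (fun _ => c + c + 4) (fun _ => hcW) (fun _ => W)
    (fun _ j => ⟨hWr j, hWcyc j, hWspt j, hWm j⟩)
  obtain ⟨SZ, hSZ⟩ : ∃ S : ℕ → Current (⊤ : Opens V) 2, ∀ j, (S j).IsRectifiable ∧
      (S j).support ⊆ closedBall x₀ (max (ρ' + 1) 0 + 1) ∧ W (ι₂ (j + 1)) - W (ι₂ j) = (S j).boundary ∧
      (S j).mass ≤ 2 * 2⁻¹ ^ j := hdata ()
  set K₂ : Set V := closedBall x₀ (max (ρ' + 1) 0 + 1) with hK₂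
  have hK₂c : IsCompact K₂ := isCompact_closedBall _ _
  have hK₁K₂ : K₁ ⊆ K₂ := closedBall_subset_closedBall (by linarith [le_max_left (ρ' + 1) 0])
  -- step 4: the composite subsequence and its data
  set ι : ℕ → ℕ := fun j => ι₁ (ι₂ j) with hιdef
  have hι : StrictMono ι := hι₁.comp hι₂
  set R : ℕ → Current (⊤ : Opens V) 1 := fun j =>
    ∑ l ∈ Finset.Ico (ι₂ j) (ι₂ (j + 1)), SB l with hR
  have hTW : ∀ k, T (ι₁ k) = W k + T (ι₁ 0) + ∑ l ∈ Finset.range k, SB l := fun k => by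
    simp only [hW]; abel
  have hdiff : ∀ j, T (ι (j + 1)) - T (ι j) = R j + (SZ j).boundary := by
    intro j
    have h12 : ι₂ j ≤ ι₂ (j + 1) := (hι₂ (Nat.lt_succ_self j)).le
    simp only [hιdef, hR]
    rw [hTW (ι₂ (j + 1)), hTW (ι₂ j), ← (hSZ j).2.2.1, Finset.sum_Ico_eq_sub _ h12]
    abel
  have hRr : ∀ j, (R j).IsRectifiable := fun j =>
    Current.IsRectifiable.finsetSum_top _ SB fun l _ => (hSB l).1
  have hRK : ∀ j, (R j).support ⊆ K₂ := fun j =>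
    (Current.support_finsetSum_subset _ SB fun l _ => (hSB l).2.1).trans hK₁K₂
  have hRm : ∀ j, (R j).mass ≤ 4 * 2⁻¹ ^ j := fun j =>
    calc (R j).mass ≤ ∑ l ∈ Finset.Ico (ι₂ j) (ι₂ (j + 1)), (SB l).mass := Current.mass_sum_le _ _
      _ ≤ ∑ l ∈ Finset.Ico (ι₂ j) (ι₂ (j + 1)), (2 : ℝ≥0∞) * 2⁻¹ ^ l :=
          Finset.sum_le_sum fun l _ => (hSB l).2.2.2
      _ ≤ 4 * 2⁻¹ ^ ι₂ j := sum_Ico_two_mul_half_pow_le _ _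
      _ ≤ 4 * 2⁻¹ ^ j :=
          mul_le_mul' le_rfl (pow_le_pow_of_le_one bot_le
            (ENNReal.inv_le_one.2 one_le_two) hι₂.le_apply)
  -- flat completeness
  obtain ⟨Rinf, Sinf, -, -, -, -, hchain, -, hflat⟩ :=
    Current.exists_flat_limit_of_tsum_ne_top hK₂c (fun j => T (ι j)) (R₀ := T (ι 0))
      (S₀ := (0 : Current (⊤ : Opens V) 2))
      (hT (ι 0)).1.1 Current.isRectifiable_zero (((hT (ι 0)).2.1.trans hρK₁).trans hK₁K₂) (by simp)
      (by rw [Current.boundary_zero, add_zero])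
      R SZ hRr (fun j => (hSZ j).1) hRK (fun j => (hSZ j).2.1) hdiff
      (by
        refine ne_top_of_le_ne_top (b := ∑' j : ℕ, 3 * ((2 : ℝ≥0∞) * 2⁻¹ ^ j)) ?_
          (ENNReal.tsum_le_tsum fun j => ?_)
        · rw [ENNReal.tsum_mul_left]
          exact ENNReal.mul_ne_top (by norm_num) tsum_two_mul_half_pow_ne_top'
        · calc (R j).mass + (SZ j).mass ≤ 4 * 2⁻¹ ^ j + 2 * 2⁻¹ ^ j := add_le_add (hRm j) (hSZ j).2.2.2
            _ = 3 * (2 * 2⁻¹ ^ j) := by ring)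
  set T' : Current (⊤ : Opens V) 1 := (T (ι 0) + Rinf) + ((0 : Current (⊤ : Opens V) 2) + Sinf).boundary
  have hweak : ∀ φ, Tendsto (fun j => T (ι j) φ) atTop (𝓝 (T' φ)) := fun φ =>
    Current.tendsto_apply_of_tendsto_integralFlatNorm hflat φ
  refine ⟨T', ι, hι, hchain, ?_, ?_, hflat, hweak⟩
  · exact Current.support_subset_of_tendsto hweak isClosed_closedBall fun j => (hT (ι j)).2.1
  · exact Current.normalMass_le_of_tendsto_integralFlatNorm
      (Eventually.of_forall fun j => (hT (ι j)).2.2) hflat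

end DimOne

/-! ### The compactness theorem from the closure theorem, all dimensions -/

section Reduction

universe u

/-- **Federer–Fleming compactness 4.2.17 (2) follows from the closure theorem 4.2.16 (1) alone.**
If weak limits of `𝐍`-bounded (`𝐍 ≤ c < ∞`; for `c = ∞` the clause would be false) sequences of
integral currents supported in a compact set are integral currents (Federer's closure theorem
[Federer1969, 4.2.16 (1)], the hypothesis `hclosure`, not proved in this tree), then the named
fact `Federer1969_compactness_integralCurrents` holds:
the flat-convergent subsequence and all bounds of its limit are supplied by
`Current.exists_subseq_flatLimit_of_isIntegral_one` (dimension `1`) and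
`Current.exists_subseq_flatLimit_of_isIntegral` (dimensions `≥ 2`), which also show that the flat
limit is the weak limit. This supersedes `Federer1969_compactness_of_closure_of_flatLimit`
(`CompactnessDegenerate.lean`), whose second hypothesis is thereby discharged.
[cite: Federer1969, 4.2.17 (2), 4.2.16 (1)] -/
theorem Federer1969_compactness_of_closure
    (hclosure : ∀ (V : Type u) [NormedAddCommGroup V] [InnerProductSpace ℝ V]
      [FiniteDimensional ℝ V] [MeasurableSpace V] [BorelSpace V] (m : ℕ) (K : Set V),
      IsCompact K → ∀ (c : ℝ≥0∞), c ≠ ⊤ → ∀ (T : ℕ → Current (⊤ : Opens V) (m + 1))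
        (T' : Current (⊤ : Opens V) (m + 1)),
        (∀ i, (T i).IsIntegral ∧ (T i).support ⊆ K ∧ (T i).normalMass ≤ c) →
        (∀ φ, Tendsto (fun i => T i φ) atTop (𝓝 (T' φ))) → T'.IsIntegral) :
    Federer1969_compactness_integralCurrents.{u} := by
  intro V _ _ _ _ _ m x₀ ρ c hc T hT
  cases m with
  | zero =>
    obtain ⟨T', ι, hι, -, hspt, hN, hflat, hweak⟩ :=
      Current.exists_subseq_flatLimit_of_isIntegral_one x₀ ρ hc T hT
    exact ⟨T', ι, hι, hclosure V 0 _ (isCompact_closedBall x₀ ρ) c hc (fun j => T (ι j)) T'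
      (fun j => hT (ι j)) hweak, hspt, hN, hflat⟩
  | succ k =>
    obtain ⟨T', ι, hι, -, hspt, hN, hflat, hweak⟩ :=
      Current.exists_subseq_flatLimit_of_isIntegral k x₀ ρ hc T hT
    exact ⟨T', ι, hι, hclosure V (k + 1) _ (isCompact_closedBall x₀ ρ) c hc (fun j => T (ι j)) T'
      (fun j => hT (ι j)) hweak, hspt, hN, hflat⟩

end Reduction

end Literature.Geometry.GeometricMeasureTheory
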